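import Literature.Analysis.Calculus.JacobianNullLagrangian
import Mathlib.Analysis.Calculus.ContDiff.CPolynomial
import Mathlib.Analysis.Calculus.ContDiff.Operations
import Mathlib.Data.Fin.SuccPred

/-!
# `StokesGeneration` (stmt-KontsevichZagierPeriods-3586) — line `fibrewise_stokes`, stub `stub_suspension_regularity`

Registered stub K4 (rung 15, Kontsevich–Zagier's rule (2): change of variables along a
face-preserving `C²` self-map of the cube, in the fibrewise-Stokes economy) of the line
`fibrewise_stokes` of the crux `StokesGeneration` (route UnfoldedStokes): **regularity of the
suspension data**.

For a `C²` map `Φ` and a `C¹` function `h` on an open set `U ⊆ ℝ^N` write `x = z ∘ castSucc`,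
`t = z last` for `z ∈ ℝ^{N+1}` and put
* `F z = ((1 - t) x + t Φ x, t)` — the **suspension** of `Φ`;
* `G y = h (y ∘ castSucc) • e_last` — the vertical field carrying the integrand.
We prove the four regularity facts used by the assembly of rung 15:
1. `W' = {z | x ∈ U ∧ (F z) ∘ castSucc ∈ U}` is open;
2. `F` is `C²` on `V = {z | x ∈ U}`;
3. wherever `y ∘ castSucc ∈ U`, `G` is differentiable at `y` and `∑ᵢ ∂ᵢ Gᵢ (y) = 0`
   (`Gᵢ = 0` for `i ≠ last`, and `G_last` does not depend on `y_last`);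
4. the Piola field `W = adj(DF) · (G ∘ F) = piolaField F G`
   (`Literature/Analysis/Calculus/JacobianNullLagrangian.lean`) is `C¹` on `W'`.

Proof sketch. The projection `P z = z ∘ castSucc` is a continuous linear map, so `V = P ⁻¹' U` is
open and `Φ ∘ P`, `h ∘ P` inherit the regularity of `Φ`, `h` on `V`; the components of `F` are
polynomial in `z` and `Φ (P z)`, whence (2), and (1) is `ContinuousOn.isOpen_inter_preimage` for
the map `z ↦ P (F z)`, continuous on the open set `V`. For (3), `G = (h ∘ P) • e_last` has
derivative `v ↦ Dh(P y)(P v) • e_last` at `y`; now `P e_last = 0` and `(e_last)ᵢ = 0` for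
`i ≠ last`. For (4), each cofactor `z ↦ det (∂₁F, …, eᵢ, …, ∂ₙF)` is `C¹` on `V`, because `DF` is
`C¹` there
(`ContDiffOn.fderiv_of_isOpen`) and the determinant is a continuous multilinear, hence smooth,
function of the rows; and `G ∘ F` is `C¹` on `W'` by the chain rule, since `F` maps `W'` into `V`.

References: M. Kontsevich, D. Zagier, *Periods* (2001), §1.2 (rule (2), change of variables);
L. C. Evans, *Partial Differential Equations* (2010), §8.1.4.b (null Lagrangians); K.-C. Chang,
*Methods in Nonlinear Analysis* (2005), Lemma 3.1.3.
-/

noncomputable section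

-- `Summit.KontsevichZagierPeriods.KontsevichZagierPeriods.…` is the tree's mandated layout (single-conjunct summit).
set_option linter.dupNamespace false

namespace Summit.KontsevichZagierPeriods.KontsevichZagierPeriods.Cruxes.StokesGeneration.FibrewiseStokes

open Function Set
open Literature.Analysis.Calculus

/-- The coordinate projection `z ↦ z ∘ castSucc : ℝ^{N+1} → ℝ^N` (forgetting the last coordinate) is
smooth. [folklore] -/
private theorem suspReg_contDiff_proj {N : ℕ} (n : WithTop ℕ∞) :
    ContDiff ℝ n (fun z : Fin (N + 1) → ℝ => fun l => z (Fin.castSucc l)) :=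
  contDiff_pi.2 fun l => contDiff_apply ℝ ℝ (Fin.castSucc l)

/-- The coordinate projection `z ↦ z ∘ castSucc` is a continuous linear map, hence its own Fréchet
derivative. [folklore] -/
private theorem suspReg_hasFDerivAt_proj {N : ℕ} (z : Fin (N + 1) → ℝ) :
    HasFDerivAt (fun z : Fin (N + 1) → ℝ => fun l => z (Fin.castSucc l))
      (ContinuousLinearMap.pi fun l =>
        ContinuousLinearMap.proj (R := ℝ) (φ := fun _ : Fin (N + 1) => ℝ) (Fin.castSucc l)) z :=
  (ContinuousLinearMap.pi fun l =>
    ContinuousLinearMap.proj (R := ℝ) (φ := fun _ : Fin (N + 1) => ℝ) (Fin.castSucc l)).hasFDerivAt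

/-- On an open set where `f : ℝⁿ → ℝⁿ` is `C²`, every cofactor
`Cᵢⱼ = det (∂₁f, …, eᵢ (slot j), …, ∂ₙf)` of its Jacobian matrix is `C¹`: the rows
`∂ₖ f = Df(·) eₖ` are `C¹` (`ContDiffOn.fderiv_of_isOpen`) and the determinant is a continuous
multilinear map of the rows. [folklore] -/
private theorem suspReg_contDiffOn_jacCofactor {ι : Type*} [Fintype ι] [DecidableEq ι]
    {f : (ι → ℝ) → ι → ℝ} {s : Set (ι → ℝ)} (hf : ContDiffOn ℝ 2 f s) (hs : IsOpen s) (i j : ι) :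
    ContDiffOn ℝ 1 (jacCofactor f i j) s := by
  have hD : ContDiffOn ℝ 1 (fderiv ℝ f) s := hf.fderiv_of_isOpen hs (by norm_num)
  have hrows : ContDiffOn ℝ 1 (fun x => update (jacCols f x) j (Pi.single i (1 : ℝ))) s := by
    refine contDiffOn_pi.2 fun k => ?_
    by_cases hkj : k = j
    · subst hkj
      simp only [update_self]
      exact contDiffOn_const
    · simp only [update_of_ne hkj]
      show ContDiffOn ℝ 1 (fun x => fderiv ℝ f x (Pi.single k 1)) s
      exact hD.clm_apply contDiffOn_const
  exact (detRowsCLM ι).contDiff.comp_contDiffOn hrows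

/-- **Registered stub `stub_suspension_regularity` (K4, rung 15): regularity of the suspension
data.** For `Φ` of class `C²` and `h` of class `C¹` on an open set `U ⊆ ℝ^N`, with the suspension
`F z = ((1 - t) x + t Φ x, t)` (`x = z ∘ castSucc`, `t = z last`) and the vertical field
`G y = h (y ∘ castSucc) e_last`: the set `W' = {x ∈ U, (F z) ∘ castSucc ∈ U}` is open, `F` is
`C²` on `{x ∈ U}`, `G` is differentiable with `∑ᵢ ∂ᵢ Gᵢ = 0` wherever `y ∘ castSucc ∈ U`, and the
Piola field `piolaField F G = adj(DF) (G ∘ F)` is `C¹` on `W'`. [folklore] -/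
theorem stub_suspension_regularity {N : ℕ} (U : Set (Fin N → ℝ)) (hU : IsOpen U)
    (Φ : (Fin N → ℝ) → (Fin N → ℝ)) (h : (Fin N → ℝ) → ℝ) (hΦ : ContDiffOn ℝ 2 Φ U)
    (hh : ContDiffOn ℝ 1 h U)
    (F : (Fin (N + 1) → ℝ) → (Fin (N + 1) → ℝ))
    (hF : F = fun z => Fin.snoc (fun k => (1 - z (Fin.last N)) * z (Fin.castSucc k) +
      z (Fin.last N) * Φ (fun l => z (Fin.castSucc l)) k) (z (Fin.last N)))
    (G : (Fin (N + 1) → ℝ) → (Fin (N + 1) → ℝ))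
    (hG : G = fun y => Pi.single (Fin.last N) (h (fun l => y (Fin.castSucc l)))) :
    IsOpen {z : Fin (N + 1) → ℝ | (fun l => z (Fin.castSucc l)) ∈ U ∧
        (fun l => F z (Fin.castSucc l)) ∈ U} ∧
    ContDiffOn ℝ 2 F {z : Fin (N + 1) → ℝ | (fun l => z (Fin.castSucc l)) ∈ U} ∧
    (∀ y : Fin (N + 1) → ℝ, (fun l => y (Fin.castSucc l)) ∈ U →
      DifferentiableAt ℝ G y ∧ ∑ i, fderiv ℝ G y (Pi.single i 1) i = 0) ∧
    ContDiffOn ℝ 1 (piolaField F G)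
      {z : Fin (N + 1) → ℝ | (fun l => z (Fin.castSucc l)) ∈ U ∧
        (fun l => F z (Fin.castSucc l)) ∈ U} := by
  set V : Set (Fin (N + 1) → ℝ) := {z | (fun l => z (Fin.castSucc l)) ∈ U}
  set W' : Set (Fin (N + 1) → ℝ) :=
    {z | (fun l => z (Fin.castSucc l)) ∈ U ∧ (fun l => F z (Fin.castSucc l)) ∈ U}
  have hW'V : W' ⊆ V := fun z hz => hz.1
  -- `V = P ⁻¹' U` is open
  have hV : IsOpen V := hU.preimage (suspReg_contDiff_proj 0).continuous
  -- the coordinates and `Φ ∘ P`, `h ∘ P` are smooth enough on `V`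
  have hlast : ∀ n : WithTop ℕ∞, ContDiffOn ℝ n (fun z : Fin (N + 1) → ℝ => z (Fin.last N)) V :=
    fun n => (contDiff_apply ℝ ℝ (Fin.last N)).contDiffOn
  have hcs : ∀ k : Fin N, ContDiffOn ℝ 2 (fun z : Fin (N + 1) → ℝ => z (Fin.castSucc k)) V :=
    fun k => (contDiff_apply ℝ ℝ (Fin.castSucc k)).contDiffOn
  have hΦP : ContDiffOn ℝ 2 (fun z : Fin (N + 1) → ℝ => Φ (fun l => z (Fin.castSucc l))) V :=
    hΦ.comp (suspReg_contDiff_proj 2).contDiffOn fun z hz => hz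
  have hhP : ContDiffOn ℝ 1 (fun z : Fin (N + 1) → ℝ => h (fun l => z (Fin.castSucc l))) V :=
    hh.comp (suspReg_contDiff_proj 1).contDiffOn fun z hz => hz
  -- (2) `F` is `C²` on `V`, coordinate by coordinate
  have hFV : ContDiffOn ℝ 2 F V := by
    refine contDiffOn_pi.2 fun i => ?_
    induction i using Fin.lastCases with
    | last =>
      simp only [hF, Fin.snoc_last]
      exact hlast 2
    | cast k =>
      simp only [hF, Fin.snoc_castSucc]
      exact ((contDiffOn_const.sub (hlast 2)).mul (hcs k)).add
        ((hlast 2).mul (contDiffOn_pi.1 hΦP k))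
  -- (1) `W' = V ∩ (P ∘ F) ⁻¹' U` is open, `P ∘ F` being continuous on the open set `V`
  have hW' : IsOpen W' := by
    have hc : ContinuousOn (fun z : Fin (N + 1) → ℝ => fun l => F z (Fin.castSucc l)) V :=
      (suspReg_contDiff_proj 0).continuous.comp_continuousOn hFV.continuousOn
    exact hc.isOpen_inter_preimage hV hU
  -- `G = (h ∘ P) • e_last`
  have hGe : G = fun y => h (fun l => y (Fin.castSucc l)) •
      (Pi.single (Fin.last N) (1 : ℝ) : Fin (N + 1) → ℝ) := by
    rw [hG]
    funext y
    rw [← Pi.single_smul', smul_eq_mul, mul_one]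
  -- (3) `G` is differentiable with zero divergence over `U`
  have h3 : ∀ y : Fin (N + 1) → ℝ, (fun l => y (Fin.castSucc l)) ∈ U →
      DifferentiableAt ℝ G y ∧ ∑ i, fderiv ℝ G y (Pi.single i 1) i = 0 := by
    intro y hy
    have hdh : DifferentiableAt ℝ h (fun l => y (Fin.castSucc l)) :=
      hh.differentiableOn_one.differentiableAt (hU.mem_nhds hy)
    have hℓ := hdh.hasFDerivAt.comp y (suspReg_hasFDerivAt_proj y)
    have hGy : HasFDerivAt G
        (((fderiv ℝ h (fun l => y (Fin.castSucc l))).comp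
          (ContinuousLinearMap.pi fun l =>
            ContinuousLinearMap.proj (R := ℝ) (φ := fun _ : Fin (N + 1) => ℝ)
              (Fin.castSucc l))).smulRight
          (Pi.single (Fin.last N) (1 : ℝ) : Fin (N + 1) → ℝ)) y := by
      rw [hGe]
      exact hℓ.smul_const _
    refine ⟨hGy.differentiableAt, ?_⟩
    rw [hGy.fderiv]
    refine Finset.sum_eq_zero fun i _ => ?_
    rw [ContinuousLinearMap.smulRight_apply, Pi.smul_apply, smul_eq_mul]
    rcases Fin.eq_castSucc_or_eq_last i with ⟨k, rfl⟩ | rfl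
    · rw [Pi.single_eq_of_ne (Fin.castSucc_ne_last k), mul_zero]
    · have h0 : (ContinuousLinearMap.pi fun l =>
          ContinuousLinearMap.proj (R := ℝ) (φ := fun _ : Fin (N + 1) => ℝ) (Fin.castSucc l))
            (Pi.single (Fin.last N) (1 : ℝ) : Fin (N + 1) → ℝ) = 0 := by
        funext l
        rw [ContinuousLinearMap.pi_apply, ContinuousLinearMap.proj_apply, Pi.zero_apply,
          Pi.single_eq_of_ne (Fin.castSucc_ne_last l)]
      rw [ContinuousLinearMap.comp_apply, h0, map_zero, zero_mul]
  -- (4) the Piola field is `C¹` on `W'`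
  have hGV : ContDiffOn ℝ 1 G V := by
    rw [hGe]
    exact hhP.smul contDiffOn_const
  have hFW' : ContDiffOn ℝ 1 F W' := (hFV.of_le (by norm_num)).mono hW'V
  have hGF : ContDiffOn ℝ 1 (G ∘ F) W' := hGV.comp hFW' fun z hz => hz.2
  have h4 : ContDiffOn ℝ 1 (piolaField F G) W' := by
    refine contDiffOn_pi.2 fun j => ?_
    show ContDiffOn ℝ 1 (fun x => ∑ i, jacCofactor F i j x * G (F x) i) W'
    exact ContDiffOn.sum fun i _ =>
      ((suspReg_contDiffOn_jacCofactor hFV hV i j).mono hW'V).mul (contDiffOn_pi.1 hGF i)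
  exact ⟨hW', hFV, h3, h4⟩

end Summit.KontsevichZagierPeriods.KontsevichZagierPeriods.Cruxes.StokesGeneration.FibrewiseStokes

end
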